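import Summits.Ventures.LatticeQCDFlow.Scaling.HomStarExchangeableLaw
import Summits.Ventures.LatticeQCDFlow.Scaling.LumpedStarStepFloor

/-!
HONEST FRAMING: exact (Metropolis-corrected) sampling algorithms for lattice gauge theory; figures
of merit are autocorrelation/cost numbers at stated couplings and volumes; no continuum-physics
claim.

# HomStarFloor — THE FLOOR AT THE SCHEME LEVEL: FOR CHAPTER U's HOMOGENEOUS REPLICA-EXCHANGE STAR, FROM THE CONFIGURATION WITH EVERY LEVEL AT `u`, THE LAW OF (HUB CONTENT,
# COMPOSITION) AFTER `n` SCHEME STEPS IS AT DISTANCE `≥ 1 − min{n·h, 1 + n·t·a}/m − π{fewer than m particles off u}` FROM ANY `π` (`h = (1−t)w_0`; `acc(·,u) ≤ a` off `u`) — THE TWO BUDGETS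
# OF CHAPTER AD FILE 6 IN SCHEME STEPS (lean-2 GEN-44, ours)

Venture-side (OURS).  Cell `lqcd-flow` (pub-lqcd), unit `pub-lqcd-lean-2-g44`, 2026-08-31.  Chapter AD, file 11 — the floor side of file 10.  By file 8 the scheme lumps onto
`S_l = t·A + (1−t)w_0·B + (1−t)(1−w_0)·I`; file 6's one-step facts (`Aφ = φ`, `Bφ ≤ φ+1`, `Bψ = ψ`, `Aψ ≤ ψ + a` for `φ = K+1−N(u)`, `ψ = φ − 𝟙{hub ≠ u}`) give `S_lφ ≤ φ + h`,
`S_lψ ≤ ψ + t·a`, hence from the `u`-crowded lumped state `E φ ≤ min{nh, 1 + nta}` (a generic budget lemma, `expect_lawAt_le_of_step`); Markov and the event form of total variation give the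
distance floor for `S_l` (`worstTvDist_ge_of_budget`, generic), and file 9's push-forward identity (`Λ_*(δ_yS^n_{scheme}) = δ_{Λy}S_lⁿ`) carries it to the scheme started at the configuration
`y_u ≡ u` (`Λ y_u` = the crowded state).

* `expect_lawAt_le_of_step`, `tvDist_ge_of_budget` (generic), `homStar_lazy_phi`, `homStar_lazy_psi` (the one-step budgets of `S_l`), **`homStar_pooled_tvDist_ge`**.

Reading (no numerics implied): with `m ≈ (K+1)/2` and file 7's half-mass (symmetric laws) the pooled observables need `Ω(K·max{1/h, 1/(ta)}) ≥ Ω(K/min{t,h})` scheme steps, against file 10's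
`O((K/(p̄·min{t,h}))·log(K/(p̄ε)))`: the homogeneous replica-exchange star's law for pooled observables is TWO-SIDED up to the persistence factors and the logarithm, at every swap rate.
Literature grade (cell rule): OWN, elementary; nothing cited; no new bib keys.
-/

noncomputable section
open Finset Function
open Literature.Probability.MarkovChains

namespace Summit.Ventures.LatticeQCDFlow.Scaling

/-! ## §1 Generic: budgets along a chain and the distance floor they give -/

section Generic
variable {X : Type*} [Fintype X] [DecidableEq X] {P : X → X → ℝ}

omit [DecidableEq X] in
/-- **A one-step budget iterates:** `Pf ≤ f + α` pointwise and `P ≥ 0` with unit rows ⇒ `E_{μPⁿ}f ≤ E_μ f + nα·Σμ` (`μ ≥ 0`). [ours] -/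
theorem expect_lawAt_le_of_step (hP : IsRowStochastic P) {f : X → ℝ} {α : ℝ} (hstep : ∀ x, ∑ y, P x y * f y ≤ f x + α)
    {μ : X → ℝ} (hμ : ∀ x, 0 ≤ μ x) (n : ℕ) :
    ∑ y, lawAt P μ n y * f y ≤ ∑ x, μ x * f x + n * α * ∑ x, μ x := by
  induction n with
  | zero => simp [lawAt_zero]
  | succ n ih =>
    have hl0 : ∀ y, 0 ≤ lawAt P μ n y := lawAt_nonneg hP hμ n
    have hmass : ∑ y, lawAt P μ n y = ∑ x, μ x := sum_lawAt hP μ n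
    rw [lawAt_succ, floor_stepLaw_expect]
    calc ∑ x, lawAt P μ n x * ∑ y, P x y * f y ≤ ∑ x, lawAt P μ n x * (f x + α) := sum_le_sum fun x _ => mul_le_mul_of_nonneg_left (hstep x) (hl0 x)
      _ = ∑ x, lawAt P μ n x * f x + α * ∑ x, lawAt P μ n x := by rw [mul_sum, ← sum_add_distrib]; exact sum_congr rfl fun x _ => by ring
      _ ≤ _ := by rw [hmass]; push_cast; nlinarith [ih]

/-- **The distance floor from a budget:** if from `x₀` the mean of `f ≥ 0` at time `n` is `≤ E`, then for every `m > 0` and every `π` of unit mass,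
`‖δ_{x₀}Pⁿ − π‖_TV ≥ 1 − E/m − π{f < m}`. [ours] -/
theorem tvDist_ge_of_budget (hP : IsRowStochastic P) {f : X → ℝ} (hf0 : ∀ y, 0 ≤ f y) (x₀ : X) (n : ℕ) {E : ℝ}
    (hE : ∑ y, lawAt P (Pi.single x₀ 1) n y * f y ≤ E) {π : X → ℝ} (hπ1 : ∑ x, π x = 1) {m : ℝ} (hm : 0 < m) :
    1 - E / m - ∑ x ∈ univ.filter (fun x => f x < m), π x ≤ tvDist (lawAt P (Pi.single x₀ 1) n) π := by
  classical
  set ν := lawAt P (Pi.single x₀ (1 : ℝ)) n with hν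
  have hμ0' : ∀ x, 0 ≤ (Pi.single x₀ (1 : ℝ) : X → ℝ) x := fun x => by by_cases h : x = x₀ <;> simp [h]
  have hl0 : ∀ y, 0 ≤ ν y := lawAt_nonneg hP hμ0' n
  have hl1 : ∑ y, ν y = 1 := by rw [hν, sum_lawAt hP, Finset.sum_pi_single']; simp
  -- Markov
  have hMarkov : m * ∑ y ∈ univ.filter (fun y => ¬ f y < m), ν y ≤ E := by
    refine le_trans ?_ hE
    rw [mul_sum, ← Finset.sum_filter_add_sum_filter_not univ (fun y => f y < m)]
    have h1 : 0 ≤ ∑ y ∈ univ.filter (fun y => f y < m), ν y * f y := sum_nonneg fun y _ => mul_nonneg (hl0 y) (hf0 y)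
    have h2 : ∑ y ∈ univ.filter (fun y => ¬ f y < m), m * ν y ≤ ∑ y ∈ univ.filter (fun y => ¬ f y < m), ν y * f y :=
      sum_le_sum fun y hy => by rw [mul_comm]; exact mul_le_mul_of_nonneg_left (not_lt.mp (mem_filter.mp hy).2) (hl0 y)
    linarith
  have hgood : 1 - E / m ≤ ∑ y ∈ univ.filter (fun y => f y < m), ν y := by
    have hsplit := Finset.sum_filter_add_sum_filter_not univ (fun y => f y < m) (fun y => ν y)
    rw [hl1] at hsplit
    have hbad : ∑ y ∈ univ.filter (fun y => ¬ f y < m), ν y ≤ E / m := by rw [le_div_iff₀ hm, mul_comm]; exact hMarkov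
    linarith
  have htv := sub_sum_le_tvDist (μ := ν) (ν := π) (by rw [hl1, hπ1]) (univ.filter (fun y => f y < m))
  linarith

end Generic

/-! ## §2 The lazy lumped kernel's budgets and the scheme-level floor -/

section SchemeFloor
variable {S : Type*} [Fintype S] [DecidableEq S] {K m : ℕ} {μ : Fin (K + 1) → S → ℝ} {M : Fin (K + 1) → S → S → ℝ} {w : Fin (K + 1) → ℝ} {t : ℝ}
variable (κ : Fin m → Fin K)
variable {X : Type*} [Fintype X] [DecidableEq X] {hub : X → S} {comp : X → S → ℕ} {acc : S → S → ℝ} {Kh : (S → ℕ) → S → S → ℝ} {Ast Bst Sl : X → X → ℝ}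
variable {Λ : (Fin (K + 1) → S) → X}

/-- **THE FLOOR AT THE SCHEME LEVEL** (see the module docstring): from the configuration `y` with every level at `u`, for every `m > 0`, every `π` of unit mass and every `n`,
`‖Λ_*(δ_yPⁿ) − π‖_TV ≥ 1 − min{n(1−t)w_0, 1 + n·t·a}/m − π{fewer than m particles off u}`. [ours] -/
theorem homStar_pooled_tvDist_ge (hm : 1 ≤ m) (hμ : ∀ k x, 0 < μ k x) (hμsum : ∀ k, ∑ u, μ k u = 1) (hhom : ∀ i : Fin K, μ i.succ = μ 1)
    (hw0 : ∀ k, 0 ≤ w k) (hw1 : ∑ k, w k = 1) (ht0 : 0 ≤ t) (ht1 : t ≤ 1)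
    (hM0 : ∀ u v, M 0 u v = μ 0 v) (hidle : ∀ i : Fin K, ∀ u v, M i.succ u v = if v = u then 1 else 0)
    {c : ℕ} (hunif : ∀ i : Fin K, (univ.filter fun r : Fin m => κ r = i).card = c)
    (hinj : ∀ x x', hub x = hub x' → comp x = comp x' → x = x')
    (hsurj : ∀ (z : S) (N : S → ℕ), ∑ v, N v = K + 1 → N z ≠ 0 → ∃ x, hub x = z ∧ comp x = N) (hhub : ∀ x, comp x (hub x) ≠ 0)
    (hsum : ∀ x, ∑ v, comp x v = K + 1) (hK : 1 ≤ K)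
    (hacc : ∀ u v, acc u v = min 1 (μ 0 v * μ 1 u / (μ 0 u * μ 1 v)))
    (hKoff : ∀ N h v, h ≠ v → Kh N h v = if N h = 0 then 0 else (N v : ℝ) / K * acc h v) (hKdiag : ∀ N h, Kh N h h = 1 - ∑ v ∈ univ.erase h, Kh N h v)
    (hA : ∀ x x', Ast x x' = if comp x' = comp x then Kh (comp x) (hub x) (hub x') else 0)
    (hB : ∀ x x', Bst x x' = μ 0 (hub x') * (if comp x' + Pi.single (hub x) 1 = comp x + Pi.single (hub x') 1 then 1 else 0))
    (hΛh : ∀ y, hub (Λ y) = y 0) (hΛc : ∀ y v, comp (Λ y) v = (univ.filter fun k : Fin (K + 1) => y k = v).card)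
    (u : S) {a : ℝ} (ha0 : 0 ≤ a) (ha : ∀ h, h ≠ u → acc h u ≤ a) {π : X → ℝ} (hπ1 : ∑ x, π x = 1) {mm : ℝ} (hmm : 0 < mm) (n : ℕ) :
    1 - min ((n : ℝ) * ((1 - t) * w 0)) (1 + n * (t * a)) / mm - ∑ x ∈ univ.filter (fun x => ((K : ℝ) + 1) - (comp x u : ℝ) < mm), π x
      ≤ tvDist (fun x' => ∑ z ∈ univ.filter (fun z => Λ z = x'),
          lawAt (fun y z => t * ptGraphSwap μ (fun r : Fin m => (((0 : Fin (K + 1)), (κ r).succ) : Fin (K + 1) × Fin (K + 1))) (fun _ : Fin m => Equiv.refl S) y z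
            + (1 - t) * prodKernel w M y z) (Pi.single (fun _ : Fin (K + 1) => u) 1) n z) π := by
  classical
  -- the lazy lumped kernel (file 9's reading) and the push-forward identity
  obtain ⟨Sl, hSl⟩ : ∃ Sl : X → X → ℝ, ∀ x x', Sl x x' = t * Ast x x' + (1 - t) * (w 0 * Bst x x' + (1 - w 0) * (if x = x' then 1 else 0)) :=
    ⟨_, fun _ _ => rfl⟩
  rw [homStar_pushforward_lawAt κ hm hμ hhom hw1 hM0 hidle hunif hacc hKoff hKdiag hA hB hSl hΛh hΛc hinj (Pi.single (fun _ : Fin (K + 1) => u) 1) n]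
  have hδ : (fun x => ∑ y' ∈ univ.filter (fun y' => Λ y' = x), (Pi.single (fun _ : Fin (K + 1) => u) (1 : ℝ) : (Fin (K + 1) → S) → ℝ) y') = Pi.single (Λ (fun _ => u)) 1 :=
    funext fun x => lumping_pushforward_single (fun _ => u) x
  rw [hδ]
  -- X5's objects: `A`, `B` stochastic (with `W = μ_1/μ_0`)
  have hW : ∀ v, 0 < μ 1 v / μ 0 v := fun v => div_pos (hμ 1 v) (hμ 0 v)
  have hacc' : ∀ h v, acc h v = min 1 ((μ 1 h / μ 0 h) / (μ 1 v / μ 0 v)) := by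
    intro h v; rw [hacc]; congr 1
    have h1 := hμ 0 h; have h2 := hμ 0 v; have h3 := hμ 1 h; have h4 := hμ 1 v
    field_simp
  have hμ00 : ∀ v, 0 ≤ μ 0 v := fun v => (hμ 0 v).le
  have hA0 : ∀ x x', 0 ≤ Ast x x' := starStep_swap_nonneg hW hacc' hK hsum hKoff hKdiag hA
  have hA1 : ∀ x, ∑ x', Ast x x' = 1 := starStep_swap_rowsum hinj hsurj hhub hsum hKoff hKdiag hA
  have hB0 : ∀ x x', 0 ≤ Bst x x' := fun x x' => by rw [hB]; exact mul_nonneg (hμ00 _) (by split_ifs <;> norm_num)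
  have hB1 : ∀ x, ∑ x', Bst x x' = 1 := starStep_redraw_rowsum hinj hsurj hhub hsum (hμsum 0) hB
  have hw01 : w 0 ≤ 1 := by
    calc w 0 ≤ ∑ k, w k := single_le_sum (fun k _ => hw0 k) (mem_univ 0)
      _ = 1 := hw1
  have hSlrs : IsRowStochastic Sl := by
    refine ⟨fun x x' => ?_, fun x => ?_⟩
    · rw [hSl]
      exact add_nonneg (mul_nonneg ht0 (hA0 x x'))
        (mul_nonneg (by linarith) (add_nonneg (mul_nonneg (hw0 0) (hB0 x x')) (mul_nonneg (by linarith) (by split_ifs <;> norm_num))))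
    · simp_rw [hSl]
      rw [sum_add_distrib, ← mul_sum, hA1, ← mul_sum, sum_add_distrib, ← mul_sum, hB1, ← mul_sum]
      rw [Finset.sum_ite_eq univ x, if_pos (mem_univ _)]; ring
  -- the one-step budgets of `S_l` from file 6's
  have hh0 : 0 ≤ (1 - t) * w 0 := mul_nonneg (by linarith) (hw0 0)
  have hk0 : 0 ≤ (1 - t) * (1 - w 0) := mul_nonneg (by linarith) (by linarith)
  have hδsum : ∀ (G : X → ℝ) (x : X), ∑ x', (if x = x' then (1 : ℝ) else 0) * G x' = G x := fun G x => by
    rw [show (∑ x', (if x = x' then (1 : ℝ) else 0) * G x') = ∑ x', (if x = x' then G x' else 0) from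
      sum_congr rfl fun x' _ => by split_ifs <;> simp, Finset.sum_ite_eq univ x, if_pos (mem_univ _)]
  have hexpand : ∀ (G : X → ℝ) (x : X), ∑ x', Sl x x' * G x'
      = t * ∑ x', Ast x x' * G x' + ((1 - t) * w 0 * ∑ x', Bst x x' * G x' + (1 - t) * (1 - w 0) * ∑ x', (if x = x' then (1 : ℝ) else 0) * G x') := by
    intro G x
    rw [show (∑ x', Sl x x' * G x') = ∑ x', (t * (Ast x x' * G x') + ((1 - t) * w 0 * (Bst x x' * G x') + (1 - t) * (1 - w 0) * ((if x = x' then (1 : ℝ) else 0) * G x')))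
      from sum_congr rfl fun x' _ => by rw [hSl]; ring]
    rw [sum_add_distrib, sum_add_distrib, ← mul_sum, ← mul_sum, ← mul_sum]
  have hφstep : ∀ x, ∑ x', Sl x x' * (((K : ℝ) + 1) - (comp x' u : ℝ)) ≤ ((K : ℝ) + 1) - (comp x u : ℝ) + (1 - t) * w 0 := by
    intro x
    rw [hexpand (fun x' => ((K : ℝ) + 1) - (comp x' u : ℝ)) x, floor_swap_phi hA hA1 u x, hδsum]
    have hb := mul_le_mul_of_nonneg_left (floor_redraw_phi (K := K) hμ00 hB hB1 u x) hh0
    nlinarith [hb, hk0]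
  have hψstep : ∀ x, ∑ x', Sl x x' * (((K : ℝ) + 1) - (comp x' u : ℝ) - (if hub x' = u then (0 : ℝ) else 1))
      ≤ ((K : ℝ) + 1) - (comp x u : ℝ) - (if hub x = u then (0 : ℝ) else 1) + t * a := by
    intro x
    rw [hexpand (fun x' => ((K : ℝ) + 1) - (comp x' u : ℝ) - (if hub x' = u then (0 : ℝ) else 1)) x, floor_redraw_psi (K := K) hB hB1 u x, hδsum]
    have hs := mul_le_mul_of_nonneg_left (floor_swap_psi hinj hsurj hhub hsum hKoff hA hA0 hA1 u ha0 ha x) ht0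
    nlinarith [hs, hh0, hk0]
  -- the budgets from the crowded state `Λ(u,…,u)`
  set x₀ := Λ (fun _ : Fin (K + 1) => u) with hx₀
  have hx₀c : comp x₀ u = K + 1 := by rw [hx₀, hΛc]; simp
  have hx₀h : hub x₀ = u := by rw [hx₀, hΛh]
  have hμ0' : ∀ x, 0 ≤ (Pi.single x₀ (1 : ℝ) : X → ℝ) x := fun x => by by_cases h : x = x₀ <;> simp [h]
  have hE1 := expect_lawAt_le_of_step hSlrs hφstep hμ0' n
  have hE2 := expect_lawAt_le_of_step hSlrs hψstep hμ0' n
  have e1 : ∑ x, (Pi.single x₀ (1 : ℝ) : X → ℝ) x * (((K : ℝ) + 1) - (comp x u : ℝ)) = 0 := by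
    rw [Finset.sum_eq_single x₀ (fun x _ hx => by simp [hx]) (fun h => absurd (mem_univ _) h)]; simp [hx₀c]
  have e2 : ∑ x, (Pi.single x₀ (1 : ℝ) : X → ℝ) x * (((K : ℝ) + 1) - (comp x u : ℝ) - (if hub x = u then (0 : ℝ) else 1)) = 0 := by
    rw [Finset.sum_eq_single x₀ (fun x _ hx => by simp [hx]) (fun h => absurd (mem_univ _) h)]; simp [hx₀c, hx₀h]
  have e3 : ∑ x, (Pi.single x₀ (1 : ℝ) : X → ℝ) x = 1 := by rw [Finset.sum_pi_single']; simp
  rw [e1, e3] at hE1; rw [e2, e3] at hE2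
  have hl0 : ∀ y, 0 ≤ lawAt Sl (Pi.single x₀ 1) n y := lawAt_nonneg hSlrs hμ0' n
  have hl1 : ∑ y, lawAt Sl (Pi.single x₀ 1) n y = 1 := by rw [sum_lawAt hSlrs, e3]
  have hE : ∑ y, lawAt Sl (Pi.single x₀ 1) n y * (((K : ℝ) + 1) - (comp y u : ℝ)) ≤ min ((n : ℝ) * ((1 - t) * w 0)) (1 + n * (t * a)) := by
    refine le_min (by linarith) ?_
    have : ∑ y, lawAt Sl (Pi.single x₀ 1) n y * (((K : ℝ) + 1) - (comp y u : ℝ))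
        ≤ ∑ y, lawAt Sl (Pi.single x₀ 1) n y * (((K : ℝ) + 1) - (comp y u : ℝ) - (if hub y = u then (0 : ℝ) else 1)) + ∑ y, lawAt Sl (Pi.single x₀ 1) n y := by
      rw [← sum_add_distrib]; exact sum_le_sum fun y _ => by split_ifs <;> nlinarith [hl0 y]
    rw [hl1] at this; linarith
  -- the distance floor
  have hφnn : ∀ y, 0 ≤ ((K : ℝ) + 1) - (comp y u : ℝ) := fun y => by
    have h := single_le_sum (f := fun v => comp y v) (fun v _ => Nat.zero_le _) (mem_univ u); rw [hsum y] at h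
    have : (comp y u : ℝ) ≤ K + 1 := by exact_mod_cast h
    linarith
  exact tvDist_ge_of_budget hSlrs hφnn x₀ n hE hπ1 hmm

end SchemeFloor

end Summit.Ventures.LatticeQCDFlow.Scaling

end
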